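import Literature.MathematicalPhysics.QuantumFieldTheory.TwistedPartitionFunctionMonotone
import Literature.MathematicalPhysics.QuantumFieldTheory.THooftElectricFlux
import HarnessLib

/-!
# 't Hooft's electric-flux weights are non-negative at every coupling: the twisted partition function is a
# positive-definite function of the temporal twist (reflection positivity through sites)

Topic `Literature/MathematicalPhysics/QuantumFieldTheory`; theorem-only sequel of
`TwistedPartitionFunctionMonotone.lean` (namespaces `InsertionSiteRP`, `MultiTwist`) in the vocabulary of
`THooftElectricFlux.lean` (namespace `THooftFlux`: `temporalTensor k`, `fluxCharacter e k = e^{-2πi(k·e)/N}`,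
`electricFluxWeight N L β m e = (1/N^n) Σ_k e^{-2πi(k·e)/N} W{m + temporalTensor k}` — 't Hooft's (5.4) on the
symmetric torus `(ℤ/Lℤ)^{n+1}`, time = direction `0`).

## The printed statement and what is proved

G. 't Hooft, Nucl. Phys. B153 (1979) 141 [tHooft1979Flux], §5: "We wish to compute the free energy `F` defined by
`e^{-βF} = Tr P(e, m) e^{-βH}` (5.1), where `H` is the Hamiltonian of the theory and `P` is a projection operator
that selects the required electric flux `e` and magnetic flux `m` … `P(e, m) = (1/N³) Σ_k e^{-2πi(k·e)/N} Ω[k]`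
(5.2) … `e^{-βF(e,m;a,β)} = (1/N³) Σ_k e^{-2πi(k·e)/N} W{k, m; a_μ}` (5.4), with `a_4 = β`, and `W` defined as in
eq. (2.6)."  In the Hamiltonian picture (5.1) is the trace of a positive operator against a projection commuting
with it, hence `≥ 0`; on the Euclidean lattice, where (5.4) is the DEFINITION (the tree's `electricFluxWeight`),
this positivity is a theorem of reflection positivity through sites (the transfer-matrix positivity), which is
what this file proves — for `SU(N)`, the fundamental Wilson action, EVERY real `β`, every even `L`, every flux
vector `e ∈ ℤ_N^n`, every purely magnetic `m`:

* ★ `sum_sum_temporalStacks_nonneg` (any compact `G`): for a `Θ'`-symmetric central background `s` and central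
  vectors `w_i`, `0 ≤ Σ_{i,i'} conj(a_i) a_{i'} Z_{s · T(w_{i'} w_i⁻¹)}` — reflection positivity
  (`InsertionSiteRP.sum_sum_glue_nonneg`) for `F = Σ_i a_i F_{s·T(w_i)}`, the glued insertions identified by
  Kanazawa's Lemma 1 eq. (11) (`⟨𝒪^{[k]} 𝒪^{[k']}⟩ = ⟨𝒪^{[k+k']}⟩`, here: coboundary moves of all temporal stacks);
* ★ `sum_sum_twistZ_nonneg` (any compact `G`): for twists `z_i` with a common spatial part,
  `0 ≤ Σ_{i,i'} conj(a_i) a_{i'} Z_{spatialPart(z_i) · z_{i'} z_i⁻¹}` — `Z` IS A POSITIVE-DEFINITE FUNCTION OF THE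
  TEMPORAL PART OF THE TWIST;
* ★★ `sun_sum_sum_twistZ_temporal_nonneg`: `0 ≤ Σ_{k,k'} conj(a_k) a_{k'} W{m + temporalTensor(k' - k)}` on `ℤ_N^n`
  (`twistOfTensor_add`, `twistOfTensor_neg`: the twist of a tensor is additive);
* ★★★ `electricFluxWeight_nonneg`, `electricFluxWeight_re_nonneg`: `0 ≤ electricFluxWeight N L β m e` (a real,
  non-negative number: the Fourier transform of a positive-definite function on a finite abelian group is
  non-negative), and `electricFluxWeight_re_le`: `≤ W{m}` (= the sum over all fluxes; Kanazawa's
  `0 ≤ ⟨ℱ^{[m]}[𝒱]⟩ ≤ 1`, Lemma 2 eq. (18), there for one temporal plane) — for every flux VECTOR `e` and every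
  purely magnetic background `m`;
* `electricFluxWeight_add_temporalTensor`: a temporal part of `m` only shifts the Fourier variable
  (`w(e; m + temporalTensor j) = conj χ_e(j) · w(e; m)`, a unimodular phase), which is why positivity is stated
  for purely magnetic `m` (as in (5.4), where `m = n_{ij}` and `k = n_{4i}`).

HONEST FRAMING: finite-volume lattice statements at every `β`; nothing about the limits `a_μ → ∞`, duality (6.3)
or the light/heavy alternatives of §7 is asserted (strong coupling: `THooftElectricFluxStrongCoupling.lean`).
The quantum-mechanical objects of (5.1)–(5.3) (`H`, `Ω[k]`, `P(e,m)`) are not formalised HERE; (5.4) is the definition.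
They ARE formalised at transfer-matrix level on the anisotropic `Fin`-box `b₁ × b₂ × b₃ × n` (any compact metrisable
`G`, `β ≥ 0`, odd sides allowed) in the `WilsonFinTorus…` chain of this directory: `e^{-H_m}` per unit time = the
slice kernel `finTorusSliceKernelTw` (`WilsonFinTorusMagneticSliceKernel.lean`; `m = 0`: `finTorusSliceKernel`,
`WilsonFinTorusSliceKernel.lean`), `Ω[k]` = `finSliceTwist` (`WilsonFinTorusTwistedPartition.lean`), `Tr P(e,m) e^{-βH}` =
`wilsonFinTorusMagneticFluxPartition` (`WilsonFinTorusMagneticFluxSectors.lean`) ∕ `wilsonFinTorusFluxTransform`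
(`WilsonFinTorusTHooftDuality.lean`), (5.3)–(5.4) = the theorems
`wilsonFinTorusTensorTwistedPartition_eq_integral_prod_finTorusSliceKernelTw` and
`wilsonFinTorusFluxTransform_eq_magneticFluxPartition`, positivity `wilsonFinTorusFluxTransform_nonneg` ∕
`wilsonFinTorusFluxTransform_re_pos_of_flux`, domination `re_wilsonFinTorusFluxTransform_le_partition`, and the `β → ∞`
energies of §5 ∕ §8 in `WilsonFinTorusMagneticFluxEnergies.lean` ∕ `WilsonFinTorusMagneticFluxGroundEnergy.lean`.
TODO(general form): identify this file's `electricFluxWeight` (symmetric torus `(ℤ/Lℤ)^{n+1}`, general tensor) with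
`wilsonFinTorusFluxTransform` (`Fin`-box, six central twists) — two vocabularies for the same (5.4).

## References
* G. 't Hooft, Nucl. Phys. B153 (1979) 141–160, §5 eqs. (5.1)–(5.4) (reprint: C. Rebbi (ed.), *Lattice Gauge
  Theories and Monte Carlo Simulations*, World Scientific, pp. 552–553). [tHooft1979Flux]
* T. Kanazawa, Ann. Phys. 324 (2009) 1634–1665, §2 Lemma 1 eq. (11), Lemma 2 eqs. (15)–(18). [Kanazawa2008]
-/

open MeasureTheory Finset Complex
open scoped ComplexConjugate ComplexOrder BigOperators

namespace Literature.MathematicalPhysics.QuantumFieldTheory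

noncomputable section

namespace MultiTwist

open WilsonRP WilsonSiteRP InsertionSiteRP QuantumLattice

/-! ## Positive semi-definiteness in the temporal stacks (any compact gauge group) -/

section General

variable {d L N : ℕ} [NeZero d] [NeZero L] {G : Type*} [Group G] [TopologicalSpace G]
  [IsTopologicalGroup G] [CompactSpace G] [MeasurableSpace G] [BorelSpace G]
  (ρ : G →* Matrix (Fin N) (Fin N) ℂ) (β : ℝ)

omit [NeZero d] [TopologicalSpace G] [IsTopologicalGroup G] [CompactSpace G] [MeasurableSpace G]
  [BorelSpace G] in
/-- `1 < L` for an even non-zero `L`. [folklore] -/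
private theorem one_lt_of_even'' (hL : Even L) : 1 < L := by
  obtain ⟨r, hr⟩ := hL
  have := NeZero.ne L
  omega

/-- ★ **The partition function with temporal stacks is a positive-definite function of the inserted
centre elements**: for a reflection-symmetric central background `s` (`sᶿ = s`) and central vectors
`w_i`, `0 ≤ Σ_{i,i'} conj(a_i) a_{i'} Z_{s · T(w_{i'} w_i⁻¹)}` — reflection positivity through sites
applied to `F = Σ_i a_i F_{s·T(w_i)}` (Kanazawa 2009, Lemma 1 eq. (11) `⟨𝒪^{[k]}𝒪^{[k']}⟩ = ⟨𝒪^{[k+k']}⟩`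
and Lemma 2 eqs. (15)–(17), there for one temporal plane; 't Hooft 1979 §5: the temporal twists `k`
conjugate to the electric flux). [cite: Kanazawa2008, §2 Lemma 1 eq. (11) and Lemma 2 eqs. (15)–(17)] [cite: tHooft1979Flux, §5 eqs. (5.1)–(5.4)] -/
theorem sum_sum_temporalStacks_nonneg (hL : Even L) (hρ : Continuous ρ) {s : Plaquette d L → G}
    (hs : ∀ p, s p ∈ Subgroup.center G) (hsymm : reflectInsertion s = s) {ι : Type*} [Fintype ι]
    {w : ι → Fin d → G} (hw : ∀ i ν, w i ν ∈ Subgroup.center G) (b : Fin d → ZMod L) (a : ι → ℂ) :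
    0 ≤ ∑ i, ∑ i', conj (a i) * a i' * (insertedPartitionFunction ρ β L
      (fun p => s p * temporalStacks (fun ν => w i' ν * (w i ν)⁻¹) (-1) b p) : ℂ) := by
  haveI : Fact (1 < L) := ⟨one_lt_of_even'' hL⟩
  set v : ι → Plaquette d L → G := fun i p => s p * temporalStacks (w i) 0 b p with hv
  have hTc : ∀ i p, temporalStacks (w i) (0 : ZMod L) b p ∈ Subgroup.center G :=
    fun i => temporalStacks_mem_center (hw i) 0 b
  have hvc : ∀ i p, v i p ∈ Subgroup.center G := fun i p => Subgroup.mul_mem _ (hs p) (hTc i p)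
  have hSh : ∀ i i' p, IsSharedPlaq p → v i p = v i' p := fun i i' p hp => by
    simp only [hv, temporalStacks_of_ne_zero _ 0 b hp.1]
  have h := sum_sum_glue_nonneg ρ hL hρ β hvc hSh a
  -- identify the glued insertions
  have hglue : ∀ i i', insertedPartitionFunction ρ β L (glueInsertion (v i) (v i')) =
      insertedPartitionFunction ρ β L
        (fun p => s p * temporalStacks (fun ν => w i' ν * (w i ν)⁻¹) (-1) b p) := by
    intro i i'
    have hrv : reflectInsertion (v i) = fun p => s p * temporalStacks (fun ν => (w i ν)⁻¹) (-1) b p := by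
      rw [hv]
      dsimp only
      rw [reflectInsertion_mul hs, hsymm, reflectInsertion_temporalStacks_zero]
    have hg : glueInsertion (v i) (v i') = fun p => (s p * temporalStacks (fun ν => (w i ν)⁻¹) (-1) b p) *
        temporalStacks (w i') 0 b p := by
      funext p
      by_cases hp : IsSiteNegPlaq p
      · rw [glueInsertion_of_neg _ _ hp, hrv]
        simp only [temporalStacks_zero_of_neg' (w i') b hp, mul_one]
      · rw [glueInsertion_of_not_neg _ _ hp]
        simp only [hv, temporalStacks_negOne_of_not_neg' _ b hp, mul_one]
    rw [hg, insertedPartitionFunction_mul_temporalStacks_succ ρ β _ (hw i') (-1) 0 (by ring) b]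
    congr 1
    funext p
    simp only [temporalStacks_mul, temporalStacks_inv, mul_assoc]
    congr 1
    exact Subgroup.mem_center_iff.1 (temporalStacks_mem_center (hw i') _ b p) _
  simp_rw [hglue] at h
  exact h
where
  /-- On negative plaquettes the temporal stacks at time `0` are trivial. [folklore] -/
  temporalStacks_zero_of_neg' [Fact (1 < L)] (w : Fin d → G) (b : Fin d → ZMod L)
      {p : Plaquette d L} (hp : IsSiteNegPlaq p) : temporalStacks w (0 : ZMod L) b p = 1 := by
    by_cases hi : p.2.1.1 = 0
    · refine temporalStacks_of_time_ne w b fun h0 => hp.1 ?_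
      unfold IsSitePosPlaq
      rw [if_pos hi, h0, ZMod.val_zero]
      have : 1 < L := Fact.out
      omega
    · exact temporalStacks_of_ne_zero w 0 b hi
  /-- Off the negative plaquettes the temporal stacks at time `-1` are trivial. [folklore] -/
  temporalStacks_negOne_of_not_neg' [Fact (1 < L)] (w : Fin d → G) (b : Fin d → ZMod L)
      {p : Plaquette d L} (hp : ¬ IsSiteNegPlaq p) : temporalStacks w (-1 : ZMod L) b p = 1 := by
    by_cases hi : p.2.1.1 = 0
    · refine temporalStacks_of_time_ne w b fun h0 => hp ⟨?_, fun hs => hs.1 hi⟩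
      unfold IsSitePosPlaq
      rw [if_pos hi, h0, ZMod.neg_val, if_neg one_ne_zero, ZMod.val_one]
      have : 1 < L := Fact.out
      omega
    · exact temporalStacks_of_ne_zero w _ b hi

end General

section ExtendMul

variable {d : ℕ} {G : Type*} [Group G]

/-- The antisymmetric extension is multiplicative in the twist (central values commute). [cite: tHooft1979Flux, §2 eq. (2.5)] -/
theorem extend_mul' (z z' : Twist d G) (k l : Fin d) :
    ((extend (z * z') k l : Subgroup.center G) : G) = (extend z k l : G) * (extend z' k l : G) := by
  rcases lt_trichotomy k l with h | rfl | h
  · rw [extend_of_lt _ h, extend_of_lt _ h, extend_of_lt _ h]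
    rfl
  · simp
  · rw [extend_of_gt _ h, extend_of_gt _ h, extend_of_gt _ h, Pi.mul_apply, mul_inv_rev,
      Subgroup.coe_mul]
    exact Subgroup.mem_center_iff.1 (z ⟨(l, k), h⟩)⁻¹.2 _

end ExtendMul

section General2

variable {d L N : ℕ} [NeZero d] [NeZero L] {G : Type*} [Group G] [TopologicalSpace G]
  [IsTopologicalGroup G] [CompactSpace G] [MeasurableSpace G] [BorelSpace G]
  (ρ : G →* Matrix (Fin N) (Fin N) ℂ) (β : ℝ)

/-- ★ **The twisted partition function is a positive-definite function of the temporal part of the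
twist** (any compact `G`): for twists `z_i` with a common spatial (magnetic) part,
`0 ≤ Σ_{i,i'} conj(a_i) a_{i'} Z_{z_{i'} z_i⁻¹ · spatialPart(z_i)}` — the twist with the common spatial
part and the temporal part `t_{i'} t_i⁻¹`. [cite: Kanazawa2008, §2 Lemma 1 eq. (11) and Lemma 2 eqs. (15)–(17)] [cite: tHooft1979Flux, §5 eqs. (5.1)–(5.4)] -/
theorem sum_sum_twistZ_nonneg (hL : Even L) (hρ : Continuous ρ) {ι : Type*} [Fintype ι]
    (z : ι → Twist d G) (hz : ∀ i i', spatialPart (z i) = spatialPart (z i')) (a : ι → ℂ) :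
    0 ≤ ∑ i, ∑ i', conj (a i) * a i' *
      (TwistedSector.twistZ ρ (spatialPart (z i) * (z i' * (z i)⁻¹)) β L : ℂ) := by
  classical
  rcases isEmpty_or_nonempty ι with hι | ⟨⟨i₀⟩⟩
  · simp
  set s : Plaquette d L → G := fun p => (plaquetteTwist (spatialPart (z i₀)) p)⁻¹ with hs_def
  have hs : ∀ p, s p ∈ Subgroup.center G := fun p => plaquetteTwist_inv_mem_center _ p
  have hsymm : reflectInsertion s = s := reflectInsertion_spatialPart (z i₀)
  have h := sum_sum_temporalStacks_nonneg ρ β hL hρ hs hsymm (ι := ι)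
    (w := fun i => temporalCornerValues (z i)) (fun i ν => temporalCornerValues_mem_center (z i) ν)
    (fun _ => -1) a
  have hid : ∀ i i', insertedPartitionFunction ρ β L (fun p => s p *
      temporalStacks (fun ν => temporalCornerValues (z i') ν * (temporalCornerValues (z i) ν)⁻¹) (-1)
        (fun _ => -1) p) =
      TwistedSector.twistZ ρ (spatialPart (z i) * (z i' * (z i)⁻¹)) β L := by
    intro i i'
    unfold TwistedSector.twistZ
    congr 1
    funext p
    rw [plaquetteTwist_inv_eq_mul (spatialPart (z i) * (z i' * (z i)⁻¹)) p]
    have hsp : spatialPart (spatialPart (z i) * (z i' * (z i)⁻¹)) = spatialPart (z i₀) := by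
      funext q
      by_cases hq : q.1.1 = 0
      · rw [spatialPart_of_eq_zero _ hq, spatialPart_of_eq_zero _ hq]
      · rw [spatialPart_of_ne_zero _ hq, Pi.mul_apply, Pi.mul_apply, Pi.inv_apply,
          spatialPart_of_ne_zero _ hq, hz i₀ i]
        have h1 : z i' q = spatialPart (z i') q := (spatialPart_of_ne_zero _ hq).symm
        have h2 : z i q = spatialPart (z i) q := (spatialPart_of_ne_zero _ hq).symm
        rw [h1, h2, hz i' i, mul_inv_cancel, mul_one]
    have htc : (fun ν => temporalCornerValues (z i') ν * (temporalCornerValues (z i) ν)⁻¹) =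
        temporalCornerValues (spatialPart (z i) * (z i' * (z i)⁻¹)) := by
      funext ν
      simp only [temporalCornerValues, extend_mul', inv_inv, mul_inv_rev]
      by_cases hν : (0 : Fin d) < ν
      · rw [extend_of_lt _ hν, extend_of_lt _ hν, extend_of_lt _ hν, extend_of_lt _ hν,
          spatialPart_of_eq_zero _ rfl, Pi.inv_apply, OneMemClass.coe_one, inv_one, mul_one,
          Subgroup.coe_inv, inv_inv]
        exact Subgroup.mem_center_iff.1 (z i ⟨(0, ν), hν⟩).2 _
      · have h0 : ν = 0 := by
          rcases (Fin.zero_le ν).lt_or_eq with h | h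
          · exact absurd h hν
          · exact h.symm
        subst h0
        simp
    rw [hsp, htc]
  simp_rw [hid] at h
  exact h

end General2

/-! ## `SU(N)`: positive-definiteness on `ℤ_N^n` and the positivity of 't Hooft's electric-flux weights -/

section SUN

variable {N n : ℕ} [NeZero N]

/-- The tree's centre phase is Mathlib's standard additive character (copy of
`QCDTwistedSlab.centerPhase_eq_stdAddChar`, not imported here). [folklore] -/
private theorem centerPhase_eq_stdAddChar' (k : ZMod N) : centerPhase N k = ZMod.stdAddChar k := by
  rw [ZMod.stdAddChar_apply, ZMod.toCircle_apply, centerPhase]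
  congr 1
  push_cast
  ring

/-- `ω^{a+b}·1 = (ω^a·1)(ω^b·1)` (copy of the tree's `suCenter_add`). [folklore] -/
private theorem suCenter_add' (a b : ZMod N) : suCenter N (a + b) = suCenter N a * suCenter N b := by
  apply Subtype.ext; apply Subtype.ext
  simp [coe_suCenter, centerPhase_eq_stdAddChar', AddChar.map_add_eq_mul, smul_smul, mul_comm]

omit [NeZero N] in
/-- `ω^0 · 1 = 1`. [folklore] -/
private theorem suCenter_zero' : suCenter N 0 = 1 := by
  apply Subtype.ext; apply Subtype.ext
  simp [coe_suCenter, centerPhase]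

/-- `suCenter N (-a) = (suCenter N a)⁻¹`. [folklore] -/
private theorem suCenter_neg' (a : ZMod N) : suCenter N (-a) = (suCenter N a)⁻¹ := by
  apply eq_inv_of_mul_eq_one_left
  rw [← suCenter_add', neg_add_cancel, suCenter_zero']

/-- One-dimensional orthogonality `Σ_{x ∈ ℤ_N} e^{-2πi x a/N} = N · [a = 0]` (copy of the tree's
`THooftFlux.sum_stdAddChar_neg_mul`, whose file is not imported here). [folklore] -/
private theorem sum_stdAddChar_neg_mul' (a : ZMod N) :
    ∑ x : ZMod N, (ZMod.stdAddChar (N := N)) (-(x * a)) = if a = 0 then (N : ℂ) else 0 := by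
  have h := AddChar.sum_mulShift (R := ZMod N) (-a) (ZMod.isPrimitive_stdAddChar N)
  simp_rw [mul_neg] at h
  rw [h, ZMod.card]
  by_cases ha : a = 0
  · simp [ha]
  · simp [ha]

/-- Orthogonality of the Fourier kernel `Σ_k e^{-2πi(k·e)/N} = N^n [e = 0]` (copy of the tree's
`THooftFlux.sum_fluxCharacter`). [folklore] -/
private theorem sum_fluxCharacter' (e : Fin n → ZMod N) :
    ∑ k : Fin n → ZMod N, THooftFlux.fluxCharacter e k = if e = 0 then (N : ℂ) ^ n else 0 := by
  classical
  have hprod := Finset.sum_prod_piFinset (Finset.univ : Finset (ZMod N))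
    (fun (j : Fin n) (x : ZMod N) => (ZMod.stdAddChar (N := N)) (-(x * e j)))
  rw [Fintype.piFinset_univ] at hprod
  unfold THooftFlux.fluxCharacter
  rw [hprod]
  simp_rw [sum_stdAddChar_neg_mul']
  by_cases he : e = 0
  · subst he
    simp
  · rw [if_neg he]
    obtain ⟨j, hj⟩ : ∃ j, e j ≠ 0 := by
      by_contra h
      push Not at h
      exact he (funext h)
    exact Finset.prod_eq_zero (Finset.mem_univ j) (if_neg hj)

/-- The twist of a sum of tensors is the product of the twists. [cite: tHooft1979Flux, §2 eq. (2.5)] -/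
theorem twistOfTensor_add (m m' : QuantumLattice.Plane (n + 1) → ZMod N) :
    twistOfTensor N (m + m') = twistOfTensor N m * twistOfTensor N m' := by
  funext q
  exact suCenter_add' (m q) (m' q)

/-- The twist of the negative tensor is the inverse twist. [cite: tHooft1979Flux, §2 eq. (2.5)] -/
theorem twistOfTensor_neg (m : QuantumLattice.Plane (n + 1) → ZMod N) :
    twistOfTensor N (-m) = (twistOfTensor N m)⁻¹ := by
  funext q
  exact suCenter_neg' (m q)

omit [NeZero N] in
/-- A twist tensor is **purely magnetic** when its temporal entries `n_{0ν}` vanish; then its twist is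
its own spatial part. [cite: tHooft1979Flux, §2 eq. (2.5)] -/
theorem spatialPart_twistOfTensor_of_magnetic {m : QuantumLattice.Plane (n + 1) → ZMod N}
    (hm : ∀ q : QuantumLattice.Plane (n + 1), q.1.1 = 0 → m q = 0) :
    spatialPart (twistOfTensor N m) = twistOfTensor N m := by
  funext q
  by_cases hq : q.1.1 = 0
  · rw [spatialPart_of_eq_zero _ hq]
    change (1 : Subgroup.center _) = suCenter N (m q)
    rw [hm q hq, suCenter_zero']
  · rw [spatialPart_of_ne_zero _ hq]

omit [NeZero N] in
/-- The spatial part of `m + temporalTensor k` is that of `m`. [cite: tHooft1979Flux, §2 eq. (2.5)] -/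
theorem spatialPart_twistOfTensor_add_temporalTensor (m : QuantumLattice.Plane (n + 1) → ZMod N)
    (k : Fin n → ZMod N) :
    spatialPart (twistOfTensor N (m + THooftFlux.temporalTensor k)) = spatialPart (twistOfTensor N m) := by
  funext q
  by_cases hq : q.1.1 = 0
  · rw [spatialPart_of_eq_zero _ hq, spatialPart_of_eq_zero _ hq]
  · rw [spatialPart_of_ne_zero _ hq, spatialPart_of_ne_zero _ hq]
    change suCenter N ((m + THooftFlux.temporalTensor k) q) = suCenter N (m q)
    rw [Pi.add_apply, THooftFlux.temporalTensor_of_ne_zero k q hq, add_zero]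

/-- ★★ **`W{m + k}` is a positive-definite function of the temporal twist `k ∈ ℤ_N^n`** for a purely
magnetic background `m`: `0 ≤ Σ_{k,k'} conj(a_k) a_{k'} W{m + temporalTensor(k' - k)}` (`SU(N)`,
fundamental Wilson action, any real `β`, `L` even). [cite: tHooft1979Flux, §5 eqs. (5.1)–(5.4)] [cite: Kanazawa2008, §2 Lemma 2 eqs. (15)–(18)] -/
theorem sun_sum_sum_twistZ_temporal_nonneg {L : ℕ} [NeZero L] (hL : Even L) (β : ℝ)
    {m : QuantumLattice.Plane (n + 1) → ZMod N} (hm : ∀ q : QuantumLattice.Plane (n + 1), q.1.1 = 0 → m q = 0)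
    {ι : Type*} [Fintype ι] (k : ι → Fin n → ZMod N) (a : ι → ℂ) :
    0 ≤ ∑ i, ∑ i', conj (a i) * a i' * (TwistedSector.twistZ (fundamentalRep (Fin N))
      (twistOfTensor N (m + THooftFlux.temporalTensor (k i' - k i))) β L : ℂ) := by
  have h := sum_sum_twistZ_nonneg (fundamentalRep (Fin N)) β hL (continuous_fundamentalRep (Fin N))
    (fun i => twistOfTensor N (m + THooftFlux.temporalTensor (k i)))
    (fun i i' => by rw [spatialPart_twistOfTensor_add_temporalTensor,
      spatialPart_twistOfTensor_add_temporalTensor]) a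
  have hid : ∀ i i', spatialPart (twistOfTensor N (m + THooftFlux.temporalTensor (k i))) *
      (twistOfTensor N (m + THooftFlux.temporalTensor (k i')) *
        (twistOfTensor N (m + THooftFlux.temporalTensor (k i)))⁻¹) =
      twistOfTensor N (m + THooftFlux.temporalTensor (k i' - k i)) := by
    intro i i'
    rw [spatialPart_twistOfTensor_add_temporalTensor, spatialPart_twistOfTensor_of_magnetic hm,
      ← twistOfTensor_neg, ← twistOfTensor_add, ← twistOfTensor_add]
    congr 1
    rw [sub_eq_add_neg, THooftFlux.temporalTensor_add, neg_add_rev]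
    have hneg : THooftFlux.temporalTensor (-k i) = -THooftFlux.temporalTensor (k i) := by
      have h0 := THooftFlux.temporalTensor_add (k i) (-k i)
      rw [add_neg_cancel, THooftFlux.temporalTensor_zero] at h0
      exact (neg_eq_of_add_eq_zero_right h0.symm).symm
    rw [hneg]
    abel
  simp_rw [hid] at h
  exact h

/-- The Fourier kernel is multiplicative in the temporal twist. [cite: tHooft1979Flux, §5 eq. (5.4)] -/
theorem fluxCharacter_add (e k k' : Fin n → ZMod N) :
    THooftFlux.fluxCharacter e (k + k') = THooftFlux.fluxCharacter e k * THooftFlux.fluxCharacter e k' := by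
  unfold THooftFlux.fluxCharacter
  rw [← Finset.prod_mul_distrib]
  refine Finset.prod_congr rfl fun j _ => ?_
  rw [← AddChar.map_add_eq_mul, Pi.add_apply]
  congr 1
  ring

/-- `conj e^{-2πi(k·e)/N} · e^{-2πi(k'·e)/N} = e^{-2πi((k'-k)·e)/N}`. [cite: tHooft1979Flux, §5 eq. (5.4)] -/
theorem conj_fluxCharacter_mul (e k k' : Fin n → ZMod N) :
    conj (THooftFlux.fluxCharacter e k) * THooftFlux.fluxCharacter e k' =
      THooftFlux.fluxCharacter e (k' - k) := by
  have hk : THooftFlux.fluxCharacter e k' = THooftFlux.fluxCharacter e (k' - k) * THooftFlux.fluxCharacter e k := by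
    rw [← fluxCharacter_add, sub_add_cancel]
  have hn : conj (THooftFlux.fluxCharacter e k) * THooftFlux.fluxCharacter e k = 1 := by
    rw [← Complex.normSq_eq_conj_mul_self, Complex.normSq_eq_norm_sq, THooftFlux.norm_fluxCharacter]
    norm_num
  rw [hk, ← mul_assoc, mul_comm (conj _), mul_assoc, hn, mul_one]

/-- ★★★ **'t Hooft's electric-flux weights are non-negative at every coupling** (Nucl. Phys. B153
(1979) §5: `e^{-βF(e,m)} = Tr P(e,m) e^{-βH}` is the trace of a positive operator over the flux
projector (5.1)–(5.3), written on the lattice as the Fourier transform (5.4) of the twisted partition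
functions; Kanazawa 2009 Lemma 2 eq. (18) `0 ≤ ⟨ℱ^{[m]}[𝒱]⟩ ≤ 1` for one temporal plane): for `SU(N)`,
the fundamental Wilson action, EVERY real `β`, every even `L`, every electric flux `e ∈ ℤ_N^n` and every
purely magnetic twist tensor `m`, the complex number `electricFluxWeight N L β m e` is `≥ 0` (real and
non-negative).  Proof: the Fourier transform of a positive-definite function on the finite abelian group
`ℤ_N^n` is non-negative. [cite: tHooft1979Flux, §5 eqs. (5.1)–(5.4)] [cite: Kanazawa2008, §2 Lemma 2 eq. (18)] -/
theorem electricFluxWeight_nonneg {L : ℕ} [NeZero L] (hL : Even L) (β : ℝ)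
    {m : QuantumLattice.Plane (n + 1) → ZMod N} (hm : ∀ q : QuantumLattice.Plane (n + 1), q.1.1 = 0 → m q = 0)
    (e : Fin n → ZMod N) : 0 ≤ THooftFlux.electricFluxWeight N L β m e := by
  set Zf : (Fin n → ZMod N) → ℂ := fun j => (TwistedSector.twistZ (fundamentalRep (Fin N))
    (twistOfTensor N (m + THooftFlux.temporalTensor j)) β L : ℂ) with hZf
  have hpsd := sun_sum_sum_twistZ_temporal_nonneg (N := N) hL β hm (ι := Fin n → ZMod N) id
    (fun k => THooftFlux.fluxCharacter e k)
  -- the double sum is `N^n Σ_j χ_e(j) W{m+j}`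
  have hsum : ∑ i : Fin n → ZMod N, ∑ i' : Fin n → ZMod N, conj (THooftFlux.fluxCharacter e i) *
      THooftFlux.fluxCharacter e i' * Zf (id i' - id i) =
      ((N : ℂ) ^ n) * ∑ j : Fin n → ZMod N, THooftFlux.fluxCharacter e j * Zf j := by
    have hinner : ∀ i : Fin n → ZMod N, ∑ i' : Fin n → ZMod N, conj (THooftFlux.fluxCharacter e i) *
        THooftFlux.fluxCharacter e i' * Zf (id i' - id i) =
        ∑ j : Fin n → ZMod N, THooftFlux.fluxCharacter e j * Zf j := by
      intro i
      simp only [id, conj_fluxCharacter_mul]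
      exact Equiv.sum_comp (Equiv.subRight i) (fun j => THooftFlux.fluxCharacter e j * Zf j)
    rw [Finset.sum_congr rfl fun i _ => hinner i, Finset.sum_const, Finset.card_univ, nsmul_eq_mul]
    congr 1
    rw [Fintype.card_fun, ZMod.card, Fintype.card_fin]
    push_cast
    ring
  rw [hsum] at hpsd
  have hN : (0 : ℝ) < (N : ℝ) ^ n := pow_pos (Nat.cast_pos.2 (NeZero.pos N)) n
  have hNne : ((N : ℂ) ^ n) ≠ 0 := pow_ne_zero _ (Nat.cast_ne_zero.2 (NeZero.ne N))
  have hinv : (0 : ℂ) ≤ ((N : ℂ) ^ n)⁻¹ := by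
    have : ((N : ℂ) ^ n)⁻¹ = ((((N : ℝ) ^ n)⁻¹ : ℝ) : ℂ) := by push_cast; ring
    rw [this]
    exact Complex.zero_le_real.2 (inv_nonneg.2 hN.le)
  have hS : (0 : ℂ) ≤ ∑ j : Fin n → ZMod N, THooftFlux.fluxCharacter e j * Zf j := by
    have h2 := mul_nonneg hinv hpsd
    rwa [← mul_assoc, inv_mul_cancel₀ hNne, one_mul] at h2
  rw [THooftFlux.electricFluxWeight_def]
  exact mul_nonneg hinv hS

/-- ★★★ Real part non-negative, imaginary part zero: `e^{-βF(e,m)} ≥ 0` is a genuine Boltzmann weight.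
[cite: tHooft1979Flux, §5 eqs. (5.1)–(5.4)] [cite: Kanazawa2008, §2 Lemma 2 eq. (18)] -/
theorem electricFluxWeight_re_nonneg {L : ℕ} [NeZero L] (hL : Even L) (β : ℝ)
    {m : QuantumLattice.Plane (n + 1) → ZMod N} (hm : ∀ q : QuantumLattice.Plane (n + 1), q.1.1 = 0 → m q = 0)
    (e : Fin n → ZMod N) :
    0 ≤ (THooftFlux.electricFluxWeight N L β m e).re ∧ (THooftFlux.electricFluxWeight N L β m e).im = 0 := by
  have h := Complex.nonneg_iff.1 (electricFluxWeight_nonneg hL β hm e)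
  exact ⟨h.1, h.2.symm⟩

/-- ★★ With the normalisation: `0 ≤ e^{-βF(e,m)} ≤ 1` after dividing by `Σ_e = W{m}` — here the
un-normalised form `Re electricFluxWeight N L β m e ≤ W{m}` (sum over all fluxes (5.2) = the `e`-independent
total, tree: `THooftFlux.sum_fluxCharacter`), i.e. Kanazawa's `⟨ℱ^{[e]}⟩ ≤ 1` for flux vectors.
[cite: Kanazawa2008, §2 Lemma 2 eq. (18)] [cite: tHooft1979Flux, §5 eqs. (5.2)–(5.4)] -/
theorem electricFluxWeight_re_le {L : ℕ} [NeZero L] (hL : Even L) (β : ℝ)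
    {m : QuantumLattice.Plane (n + 1) → ZMod N} (hm : ∀ q : QuantumLattice.Plane (n + 1), q.1.1 = 0 → m q = 0)
    (e : Fin n → ZMod N) :
    (THooftFlux.electricFluxWeight N L β m e).re ≤
      TwistedSector.twistZ (fundamentalRep (Fin N)) (twistOfTensor N m) β L := by
  -- `Σ_{e'} w(e') = W{m}` and every term is `≥ 0`
  classical
  have hsum : ∑ e' : Fin n → ZMod N, THooftFlux.electricFluxWeight N L β m e' =
      (TwistedSector.twistZ (fundamentalRep (Fin N)) (twistOfTensor N m) β L : ℂ) := by
    simp only [THooftFlux.electricFluxWeight_def, ← Finset.mul_sum]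
    rw [Finset.sum_comm]
    have hk : ∀ k : Fin n → ZMod N, ∑ e' : Fin n → ZMod N, THooftFlux.fluxCharacter e' k *
        (TwistedSector.twistZ (fundamentalRep (Fin N)) (twistOfTensor N (m + THooftFlux.temporalTensor k)) β L : ℂ) =
        (if k = 0 then (N : ℂ) ^ n else 0) *
          (TwistedSector.twistZ (fundamentalRep (Fin N)) (twistOfTensor N (m + THooftFlux.temporalTensor k)) β L : ℂ) := by
      intro k
      rw [← Finset.sum_mul]
      congr 1
      have hswap : ∀ e' : Fin n → ZMod N, THooftFlux.fluxCharacter e' k = THooftFlux.fluxCharacter k e' := by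
        intro e'
        unfold THooftFlux.fluxCharacter
        exact Finset.prod_congr rfl fun j _ => by rw [mul_comm]
      simp_rw [hswap]
      exact sum_fluxCharacter' k
    simp_rw [hk]
    rw [Finset.sum_eq_single (0 : Fin n → ZMod N) (fun k _ hk0 => by rw [if_neg hk0, zero_mul])
      (fun h => absurd (Finset.mem_univ _) h)]
    rw [if_pos rfl, THooftFlux.temporalTensor_zero, add_zero, ← mul_assoc,
      inv_mul_cancel₀ (pow_ne_zero _ (Nat.cast_ne_zero.2 (NeZero.ne N))), one_mul]
  have hre : (∑ e' : Fin n → ZMod N, THooftFlux.electricFluxWeight N L β m e').re =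
      TwistedSector.twistZ (fundamentalRep (Fin N)) (twistOfTensor N m) β L := by
    rw [hsum, Complex.ofReal_re]
  rw [Complex.re_sum] at hre
  rw [← hre, ← Finset.sum_erase_add _ _ (Finset.mem_univ e)]
  have hrest : 0 ≤ ∑ e' ∈ (Finset.univ : Finset (Fin n → ZMod N)).erase e,
      (THooftFlux.electricFluxWeight N L β m e').re :=
    Finset.sum_nonneg fun e' _ => (electricFluxWeight_re_nonneg hL β hm e').1
  linarith

/-- A general twist tensor: its temporal entries only shift the Fourier variable, so the weight picks up
the unimodular phase `e^{+2πi(m_t·e)/N}` — `w(e; m + temporalTensor j) = conj(χ_e(j)) · w(e; m)`.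
[cite: tHooft1979Flux, §5 eq. (5.4)] -/
theorem electricFluxWeight_add_temporalTensor {L : ℕ} [NeZero L] (β : ℝ)
    (m : QuantumLattice.Plane (n + 1) → ZMod N) (j e : Fin n → ZMod N) :
    THooftFlux.electricFluxWeight N L β (m + THooftFlux.temporalTensor j) e =
      conj (THooftFlux.fluxCharacter e j) * THooftFlux.electricFluxWeight N L β m e := by
  rw [THooftFlux.electricFluxWeight_def, THooftFlux.electricFluxWeight_def]
  have hn : conj (THooftFlux.fluxCharacter e j) * THooftFlux.fluxCharacter e j = 1 := by
    rw [← Complex.normSq_eq_conj_mul_self, Complex.normSq_eq_norm_sq, THooftFlux.norm_fluxCharacter]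
    norm_num
  have hre : ∑ k : Fin n → ZMod N, THooftFlux.fluxCharacter e k *
      (TwistedSector.twistZ (fundamentalRep (Fin N)) (twistOfTensor N (m + THooftFlux.temporalTensor k)) β L : ℂ) =
      ∑ k : Fin n → ZMod N, THooftFlux.fluxCharacter e (k + j) *
        (TwistedSector.twistZ (fundamentalRep (Fin N))
          (twistOfTensor N (m + THooftFlux.temporalTensor (k + j))) β L : ℂ) :=
    (Equiv.sum_comp (Equiv.addRight j) (fun k => THooftFlux.fluxCharacter e k *
      (TwistedSector.twistZ (fundamentalRep (Fin N))
        (twistOfTensor N (m + THooftFlux.temporalTensor k)) β L : ℂ))).symm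
  rw [hre, Finset.mul_sum, Finset.mul_sum, Finset.mul_sum]
  refine Finset.sum_congr rfl fun k _ => ?_
  rw [fluxCharacter_add, THooftFlux.temporalTensor_add, ← add_assoc, add_right_comm m _ _]
  calc ((N : ℂ) ^ n)⁻¹ * (THooftFlux.fluxCharacter e k *
        (TwistedSector.twistZ (fundamentalRep (Fin N))
          (twistOfTensor N (m + THooftFlux.temporalTensor k + THooftFlux.temporalTensor j)) β L : ℂ))
      = (conj (THooftFlux.fluxCharacter e j) * THooftFlux.fluxCharacter e j) * (((N : ℂ) ^ n)⁻¹ *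
          (THooftFlux.fluxCharacter e k * (TwistedSector.twistZ (fundamentalRep (Fin N))
            (twistOfTensor N (m + THooftFlux.temporalTensor k + THooftFlux.temporalTensor j)) β L : ℂ))) := by
        rw [hn, one_mul]
    _ = _ := by ring

/-! ## Revision 1 (lit-2 g26): the zero-flux sector dominates, at every coupling ('t Hooft §7.1)

't Hooft, §7.1 (reprint p. 555): «A further restriction follows from the requirement that W in eq. (5.4) must be
positive: if (e, m) is a light flux, then (0, m) must also be a light flux.»  The finite-volume fact behind this
sentence is the triangle inequality in (5.4): `|e^{-βF(e,m)}| ≤ e^{-βF(0,m)}` since `|e^{2πi k·e/N}| = 1` and every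
`W{m+k} > 0` — for EVERY `β`, `L`, `N`, `e` and base tensor `m` (no reflection positivity is needed for this
half; with `electricFluxWeight_nonneg` it gives `0 ≤ e^{-βF(e,m)} ≤ e^{-βF(0,m)}` for purely magnetic `m` and
even `L`, i.e. `F(e,m) ≥ F(0,m) `: a light `(e,m)` forces a light `(0,m)`).  Nothing about the limit `a_μ → ∞`
(where "light"/"heavy" are defined) is asserted.
-/

/-- **The zero-electric-flux weight dominates**: `‖e^{-βF(e,m)}‖ ≤ e^{-βF(0,m)} = (1/N^n) Σ_k W{m+k}` for every
real `β`, every `L`, every flux vector `e` and every base tensor `m` (triangle inequality in (5.4): the Fourier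
kernel is unimodular and the twisted partition functions are positive).
[cite: tHooft1979Flux, §5 eq. (5.4) and §7.1 «if (e, m) is a light flux, then (0, m) must also be a light flux»] -/
theorem norm_electricFluxWeight_le_re_zero (L : ℕ) [NeZero L] (β : ℝ)
    (m : QuantumLattice.Plane (n + 1) → ZMod N) (e : Fin n → ZMod N) :
    ‖THooftFlux.electricFluxWeight N L β m e‖ ≤ (THooftFlux.electricFluxWeight N L β m 0).re := by
  have hW : ∀ k : Fin n → ZMod N, 0 < TwistedSector.twistZ (fundamentalRep (Fin N))
      (twistOfTensor N (m + THooftFlux.temporalTensor k)) β L := fun k => by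
    unfold TwistedSector.twistZ
    exact insertedPartitionFunction_pos _ (continuous_fundamentalRep (Fin N)) β _
  have hre : (THooftFlux.electricFluxWeight N L β m 0).re = ((N : ℝ) ^ n)⁻¹ * ∑ k : Fin n → ZMod N,
      TwistedSector.twistZ (fundamentalRep (Fin N)) (twistOfTensor N (m + THooftFlux.temporalTensor k)) β L := by
    rw [THooftFlux.electricFluxWeight_zero, ← Complex.ofReal_sum, ← Complex.ofReal_natCast, ← Complex.ofReal_pow,
      ← Complex.ofReal_inv, ← Complex.ofReal_mul, Complex.ofReal_re]
  have hNn : (0 : ℝ) ≤ ((N : ℝ) ^ n)⁻¹ := by positivity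
  rw [hre, THooftFlux.electricFluxWeight_def, norm_mul]
  have hnormN : ‖((N : ℂ) ^ n)⁻¹‖ = ((N : ℝ) ^ n)⁻¹ := by
    rw [norm_inv, norm_pow, Complex.norm_natCast]
  rw [hnormN]
  refine mul_le_mul_of_nonneg_left ((norm_sum_le _ _).trans (le_of_eq (Finset.sum_congr rfl fun k _ => ?_))) hNn
  rw [norm_mul, THooftFlux.norm_fluxCharacter, one_mul, Complex.norm_real, Real.norm_eq_abs, abs_of_pos (hW k)]

/-- `Re e^{-βF(e,m)} ≤ e^{-βF(0,m)}` for every `β`, `L`, `e`, `m`. [cite: tHooft1979Flux, §5 eq. (5.4) and §7.1] -/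
theorem electricFluxWeight_re_le_re_zero (L : ℕ) [NeZero L] (β : ℝ)
    (m : QuantumLattice.Plane (n + 1) → ZMod N) (e : Fin n → ZMod N) :
    (THooftFlux.electricFluxWeight N L β m e).re ≤ (THooftFlux.electricFluxWeight N L β m 0).re :=
  (Complex.re_le_norm _).trans (norm_electricFluxWeight_le_re_zero L β m e)

/-- ★ **`0 ≤ e^{-βF(e,m)} ≤ e^{-βF(0,m)}`** for purely magnetic `m` and even `L`, at every coupling: the weights
(5.4) are real, non-negative (reflection positivity, `electricFluxWeight_re_nonneg`) and dominated by the
zero-flux weight of the same magnetic sector — the lattice content of «W in eq. (5.4) must be positive: if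
(e, m) is a light flux, then (0, m) must also be a light flux». [cite: tHooft1979Flux, §5 eq. (5.4) and §7.1] -/
theorem electricFluxWeight_re_mem_Icc {L : ℕ} [NeZero L] (hL : Even L) (β : ℝ)
    {m : QuantumLattice.Plane (n + 1) → ZMod N} (hm : ∀ q : QuantumLattice.Plane (n + 1), q.1.1 = 0 → m q = 0)
    (e : Fin n → ZMod N) :
    (THooftFlux.electricFluxWeight N L β m e).re ∈
        Set.Icc 0 (THooftFlux.electricFluxWeight N L β m 0).re ∧
      (THooftFlux.electricFluxWeight N L β m e).im = 0 :=
  ⟨⟨(electricFluxWeight_re_nonneg hL β hm e).1, electricFluxWeight_re_le_re_zero L β m e⟩,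
    (electricFluxWeight_re_nonneg hL β hm e).2⟩

end SUN

end MultiTwist

end

end Literature.MathematicalPhysics.QuantumFieldTheory
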